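import Mathlib
import Literature.NumberTheory.LFunctions.Zhang2022.Section8FrontEnd82
import Literature.NumberTheory.LFunctions.Zhang2022.Section18SjNormMajorant
import Literature.NumberTheory.LFunctions.Zhang2022.Section3Lemma31
import Literature.NumberTheory.LFunctions.Zhang2022.TypedSection01and02B
import HarnessLib

/-!
# Zhang (2022) §8 p. 47, the "simple approximation" `Z22:§8.u044`: sizes of the main terms and
# of the inner sums of `S_j(𝐚₁₁,𝐚₂₁)` on the tail ranges

Topic `Literature/NumberTheory/LFunctions/Zhang2022` (Landau–Siegel audit tree; verdict-neutral).
Y. Zhang, *Discrete mean estimates and the Landau–Siegel zero*, arXiv:2211.02515v1 (2022)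
[Zhang2022LandauSiegel] — **an unrefereed manuscript under adjudication**; D-0069 campaign, cell
`siegel-zhang`, DISCHARGE lane, node `Z22:§8.u044` (tex L2436, PDF p. 47; GAP row G-d20-1).
Theorem-only, unconditional, from the definitions ((2.13), (2.22), (8.6), Lemmas 8.2/8.4's
`𝔣_{jμ}`, `𝔤_{jμ}`) and the tree's bound `|L′(w,χ)| ≤ 2e^{9/2}(1+𝓛)𝓛` near `w = 1`
(`Lemma31.norm_deriv_LFunction_le_near_one`). These are the "size" inputs of the reduction
`DedStep8u044 ⇐ XiZeroTailMean` (file `Section8FrontEnd44Reduction`):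

* `norm_iota2_le_two` — `|ι₂| ≤ 2` ((2.26));
* `norm_frakfW_le`, `norm_frakgW_le` — `𝔣_{jμ}(y), 𝔤_{jμ}(y) = O_{c′}(1)` (explicit) uniformly in
  `1 ≤ y ≤ P`, `D ≥ 3`, `μ ∈ {6,7}` (all shifts are purely imaginary and `≍ α`, `α log P = π`);
* `norm_deriv_LFunction_one_le` — `|L′(1,χ)| ≤ 4e^{9/2}𝓛²` for `χ` primitive, `𝓛 ≥ 3`;
* `norm_msum_tail_le`, `norm_nsum_tail_le` — the trivial bounds for the inner sums of `S_j(𝐚₁₁,𝐚₂₁)`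
  at `x = P_k/dr ≥ 1`: `|Σ_m χ(m)ϰ_k(drm)m^{−(1−β_j)}| ≤ (log x/log P_k)(1 + log x)` and
  `|Σ_n χ(n)ϰ̄_k(drn)ξ₀ⱼ(n;d,r)/n| ≤ (log x/log P_k)·Σ_{n<x}|ξ₀ⱼ(n;d,r)|/n` (from
  `|ϰ_k(drm)| = log(x/m)/log P_k ≤ log x/log P_k`, (8.6));
* `norm_mul_mul_sub_le`, `norm_mul_sub_le` — the bookkeeping inequalities
  `|XY − AB| ≤ |X − A||Y| + |A||Y − B|` in the shape used range by range.

WHAT THIS FILE IS NOT: any claim of the manuscript; nothing here bears on its Theorems 1–2 or on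
Landau–Siegel zeros. No definition, no new fact.

## References

* Y. Zhang, arXiv:2211.02515v1 (2022), §8 p. 47 (tex L2420–L2442), (8.6), Lemmas 8.2/8.4; §2
  (2.13), (2.22), (2.26). [cite: Zhang2022LandauSiegel, §8 p.47]
-/

noncomputable section

open Complex Real ComplexConjugate Finset

namespace Literature.NumberTheory.LFunctions.Zhang2022.Section8FrontEnd44Sizes

open Literature.NumberTheory.LFunctions.Zhang2022.Skeleton
open Literature.NumberTheory.LFunctions.Zhang2022.Section8FrontEnd82

/-! ## `|ι₂| ≤ 2` -/

/-- `|ι₂| ≤ 2` for `ι₂ = 0.94977 − 1.38995i` of (2.26). [cite: Zhang2022LandauSiegel, §2 (2.26) p.10] -/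
theorem norm_iota2_le_two : ‖iota2‖ ≤ 2 := by
  have h : ‖iota2‖ ^ 2 ≤ 2 ^ 2 := by
    rw [Complex.sq_norm, iota2]
    simp [Complex.normSq_apply]
    norm_num
  exact le_of_pow_le_pow_left₀ two_ne_zero (by norm_num) h

/-! ## The shifts: purely imaginary and `≍ α` -/

/-- `α log P = π`. [cite: Zhang2022LandauSiegel, §2 (2.10)] -/
theorem alpha_mul_ell9 {D : ℕ} (hL : 0 < ell D) : alpha D * ell D ^ 9 = π := by
  rw [Section2.alpha_eq_pi_div_ell9]; field_simp

/-- `β_μ` is `3iα/2` or `5iα/2`: `Re β_μ = 0` and `3α/2 ≤ |β_μ| ≤ 5α/2` (for `α ≥ 0`).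
[cite: Zhang2022LandauSiegel, §2 (2.22) p.10] -/
theorem betaMu_facts {D : ℕ} (hα : 0 ≤ alpha D) (μ : ℕ) :
    (betaMu D μ).re = 0 ∧ 3 * alpha D / 2 ≤ ‖betaMu D μ‖ ∧ ‖betaMu D μ‖ ≤ 5 * alpha D / 2 := by
  unfold betaMu beta6 beta7
  split_ifs
  · refine ⟨by simp [Complex.mul_re, Complex.mul_im], ?_, ?_⟩ <;>
    · rw [norm_div, norm_mul, norm_mul, Complex.norm_I, Complex.norm_real, Real.norm_of_nonneg hα]
      norm_num
      try linarith
  · refine ⟨by simp [Complex.mul_re, Complex.mul_im], ?_, ?_⟩ <;>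
    · rw [norm_div, norm_mul, norm_mul, Complex.norm_I, Complex.norm_real, Real.norm_of_nonneg hα]
      norm_num
      try linarith

/-- `|β_j| ≤ 3α(1 + 20|c′|)` for `D ≥ 3` (from the tree's `|β_j| ≤ 3α(1 + 5|c′|α𝓛)` and
`α𝓛 = π𝓛⁻⁸ ≤ 4`). [cite: Zhang2022LandauSiegel, §2 (2.13) p.6] -/
theorem norm_betaJ_le' (c' : ℝ) {D : ℕ} (hD : 3 ≤ D) (j : ℕ) :
    ‖betaJ c' D j‖ ≤ 3 * alpha D * (1 + 20 * |c'|) := by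
  have h := Sec18SjNorm.norm_betaJ_le c' D hD j
  have hL1 : 1 < ell D := one_lt_ell hD
  have hL0 : 0 < ell D := by linarith
  have hα0 : 0 < alpha D := by rw [Section2.alpha_eq_pi_div_ell9]; positivity
  have hαL : alpha D * ell D ≤ 4 := by
    rw [Section2.alpha_eq_pi_div_ell9, div_mul_eq_mul_div, div_le_iff₀ (by positivity)]
    have hπ : π ≤ 4 := Real.pi_le_four
    have h9 : ell D ≤ ell D ^ 9 := by
      calc ell D = ell D ^ 1 := (pow_one _).symm
        _ ≤ ell D ^ 9 := pow_le_pow_right₀ hL1.le (by norm_num)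
    nlinarith
  calc ‖betaJ c' D j‖ ≤ 3 * alpha D * (1 + 5 * |c'| * alpha D * ell D) := h
    _ ≤ 3 * alpha D * (1 + 20 * |c'|) := by
        apply mul_le_mul_of_nonneg_left _ (by positivity)
        have : 5 * |c'| * alpha D * ell D = 5 * |c'| * (alpha D * ell D) := by ring
        rw [this]; nlinarith [abs_nonneg c']

/-! ## `𝔣_{jμ}`, `𝔤_{jμ}` are bounded on `[1, P]` -/

/-- **`|𝔣_{jμ}(y)| ≤ 1 + (5.5 + 60|c′|)π` for `1 ≤ y ≤ P`, `D ≥ 3`** (`𝔣_{jμ}(y) = (1 + (β_μ − β_j)log y)y^{β_μ}`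
with purely imaginary shifts of size `≤ (5.5 + 60|c′|)α` in total and `α log P = π`).
[cite: Zhang2022LandauSiegel, §8 Lemma 8.2 p.45] -/
theorem norm_frakfW_le (c' : ℝ) {D : ℕ} (hD : 3 ≤ D) (j μ : ℕ) {y : ℝ} (hy1 : 1 ≤ y)
    (hyP : y ≤ bigP D) : ‖frakfW c' D j μ y‖ ≤ 1 + (5.5 + 60 * |c'|) * π := by
  have hL1 : 1 < ell D := one_lt_ell hD
  have hL0 : 0 < ell D := by linarith
  have hα0 : 0 < alpha D := by rw [Section2.alpha_eq_pi_div_ell9]; positivity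
  obtain ⟨hμre, -, hμle⟩ := betaMu_facts hα0.le μ
  have hj := norm_betaJ_le' c' hD j
  have hlog0 : 0 ≤ Real.log y := Real.log_nonneg hy1
  have hlogP : Real.log y ≤ ell D ^ 9 := by
    calc Real.log y ≤ Real.log (bigP D) := Real.log_le_log (by linarith) hyP
      _ = ell D ^ 9 := by rw [bigP, Real.log_exp]
  have hexp : ‖cexp (betaMu D μ * (Real.log y : ℂ))‖ = 1 := by
    rw [Complex.norm_exp, Complex.mul_re, hμre, Complex.ofReal_re, Complex.ofReal_im]; simp
  rw [frakfW, frakf, norm_mul, hexp, mul_one]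
  calc ‖1 + (betaMu D μ - betaJ c' D j) * (Real.log y : ℂ)‖
      ≤ ‖(1 : ℂ)‖ + ‖(betaMu D μ - betaJ c' D j) * (Real.log y : ℂ)‖ := norm_add_le _ _
    _ ≤ 1 + (‖betaMu D μ‖ + ‖betaJ c' D j‖) * Real.log y := by
        rw [norm_one, norm_mul, Complex.norm_real, Real.norm_of_nonneg hlog0]
        gcongr; exact norm_sub_le _ _
    _ ≤ 1 + (5 * alpha D / 2 + 3 * alpha D * (1 + 20 * |c'|)) * ell D ^ 9 := by
        gcongr
    _ = 1 + (5.5 + 60 * |c'|) * (alpha D * ell D ^ 9) := by ring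
    _ = 1 + (5.5 + 60 * |c'|) * π := by rw [alpha_mul_ell9 hL0]

/-- **`|𝔤_{jμ}(y)| ≤ G₀(c′)` for `1 ≤ y ≤ P`, `D ≥ 3`**, with the explicit
`G₀ = 1 + 8(1+20|c′|)² + (5.5 + 60|c′|)²π` (`𝔤 = b₁b₂β_μ⁻² + (1 − b₁b₂β_μ⁻² − (b₁−β_μ)(b₂−β_μ)β_μ⁻¹log y)y^{−β_μ}`,
`|b_k| ≤ 3α(1+20|c′|)`, `|β_μ| ≥ 3α/2`, `α log P = π`). [cite: Zhang2022LandauSiegel, §8 Lemma 8.4 p.46] -/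
theorem norm_frakgW_le (c' : ℝ) {D : ℕ} (hD : 3 ≤ D) (j μ : ℕ) {y : ℝ} (hy1 : 1 ≤ y)
    (hyP : y ≤ bigP D) :
    ‖frakgW c' D j μ y‖ ≤ 1 + 8 * (1 + 20 * |c'|) ^ 2 + (5.5 + 60 * |c'|) ^ 2 * π := by
  have hL1 : 1 < ell D := one_lt_ell hD
  have hL0 : 0 < ell D := by linarith
  have hα0 : 0 < alpha D := by rw [Section2.alpha_eq_pi_div_ell9]; positivity
  obtain ⟨hμre, hμge, hμle⟩ := betaMu_facts hα0.le μ
  have hμ0 : betaMu D μ ≠ 0 := by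
    intro h; rw [h, norm_zero] at hμge; linarith
  have hμpos : 0 < ‖betaMu D μ‖ := norm_pos_iff.mpr hμ0
  set B : ℝ := 3 * alpha D * (1 + 20 * |c'|) with hB
  have hB0 : 0 ≤ B := by positivity
  have h1 := norm_betaJ_le' c' hD (j + 1)
  have h2 := norm_betaJ_le' c' hD (j + 2)
  have hlog0 : 0 ≤ Real.log y := Real.log_nonneg hy1
  have hlogP : Real.log y ≤ ell D ^ 9 := by
    calc Real.log y ≤ Real.log (bigP D) := Real.log_le_log (by linarith) hyP
      _ = ell D ^ 9 := by rw [bigP, Real.log_exp]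
  have hexp : ‖cexp (-(betaMu D μ * (Real.log y : ℂ)))‖ = 1 := by
    rw [Complex.norm_exp, Complex.neg_re, Complex.mul_re, hμre, Complex.ofReal_re, Complex.ofReal_im]
    simp
  -- the ratio `b₁b₂/β_μ²`
  have hratio : ‖betaJ c' D (j + 1) * betaJ c' D (j + 2) / betaMu D μ ^ 2‖ ≤ 4 * (1 + 20 * |c'|) ^ 2 := by
    rw [norm_div, norm_mul, norm_pow, div_le_iff₀ (by positivity)]
    calc ‖betaJ c' D (j + 1)‖ * ‖betaJ c' D (j + 2)‖ ≤ B * B :=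
          mul_le_mul h1 h2 (norm_nonneg _) hB0
      _ = 4 * (1 + 20 * |c'|) ^ 2 * (3 * alpha D / 2) ^ 2 := by rw [hB]; ring
      _ ≤ 4 * (1 + 20 * |c'|) ^ 2 * ‖betaMu D μ‖ ^ 2 := by gcongr
  -- the coefficient `(b₁−β_μ)(b₂−β_μ)/β_μ · log y`
  have hcoef : ‖(betaJ c' D (j + 1) - betaMu D μ) * (betaJ c' D (j + 2) - betaMu D μ) / betaMu D μ *
      (Real.log y : ℂ)‖ ≤ (5.5 + 60 * |c'|) ^ 2 * π := by
    have hd1 : ‖betaJ c' D (j + 1) - betaMu D μ‖ ≤ B + 5 * alpha D / 2 :=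
      (norm_sub_le _ _).trans (add_le_add h1 hμle)
    have hd2 : ‖betaJ c' D (j + 2) - betaMu D μ‖ ≤ B + 5 * alpha D / 2 :=
      (norm_sub_le _ _).trans (add_le_add h2 hμle)
    have hsum : B + 5 * alpha D / 2 = (5.5 + 60 * |c'|) * alpha D := by rw [hB]; ring
    rw [norm_mul, norm_div, norm_mul, Complex.norm_real, Real.norm_of_nonneg hlog0]
    rw [hsum] at hd1 hd2
    have hnum : ‖betaJ c' D (j + 1) - betaMu D μ‖ * ‖betaJ c' D (j + 2) - betaMu D μ‖ ≤
        ((5.5 + 60 * |c'|) * alpha D) ^ 2 := by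
      rw [sq]; exact mul_le_mul hd1 hd2 (norm_nonneg _) (by positivity)
    calc ‖betaJ c' D (j + 1) - betaMu D μ‖ * ‖betaJ c' D (j + 2) - betaMu D μ‖ / ‖betaMu D μ‖ *
          Real.log y
        ≤ ((5.5 + 60 * |c'|) * alpha D) ^ 2 / (3 * alpha D / 2) * ell D ^ 9 := by
          gcongr
      _ = (5.5 + 60 * |c'|) ^ 2 * (2 / 3) * (alpha D * ell D ^ 9) := by
          field_simp
      _ = (5.5 + 60 * |c'|) ^ 2 * (2 / 3) * π := by rw [alpha_mul_ell9 hL0]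
      _ ≤ (5.5 + 60 * |c'|) ^ 2 * π := by
          nlinarith [Real.pi_pos, sq_nonneg (5.5 + 60 * |c'|),
            mul_nonneg (sq_nonneg (5.5 + 60 * |c'|)) Real.pi_pos.le]
  rw [frakgW, frakg]
  calc ‖betaJ c' D (j + 1) * betaJ c' D (j + 2) / betaMu D μ ^ 2 +
        (1 - betaJ c' D (j + 1) * betaJ c' D (j + 2) / betaMu D μ ^ 2 -
            (betaJ c' D (j + 1) - betaMu D μ) * (betaJ c' D (j + 2) - betaMu D μ) / betaMu D μ *
              (Real.log y : ℂ)) * cexp (-(betaMu D μ * (Real.log y : ℂ)))‖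
      ≤ ‖betaJ c' D (j + 1) * betaJ c' D (j + 2) / betaMu D μ ^ 2‖ +
        ‖1 - betaJ c' D (j + 1) * betaJ c' D (j + 2) / betaMu D μ ^ 2 -
            (betaJ c' D (j + 1) - betaMu D μ) * (betaJ c' D (j + 2) - betaMu D μ) / betaMu D μ *
              (Real.log y : ℂ)‖ * 1 := by
        rw [← hexp]; exact (norm_add_le _ _).trans (by rw [norm_mul])
    _ ≤ 4 * (1 + 20 * |c'|) ^ 2 + (1 + 4 * (1 + 20 * |c'|) ^ 2 + (5.5 + 60 * |c'|) ^ 2 * π) := by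
        rw [mul_one]
        gcongr
        calc ‖1 - betaJ c' D (j + 1) * betaJ c' D (j + 2) / betaMu D μ ^ 2 -
              (betaJ c' D (j + 1) - betaMu D μ) * (betaJ c' D (j + 2) - betaMu D μ) / betaMu D μ *
                (Real.log y : ℂ)‖
            ≤ ‖(1 : ℂ) - betaJ c' D (j + 1) * betaJ c' D (j + 2) / betaMu D μ ^ 2‖ +
              ‖(betaJ c' D (j + 1) - betaMu D μ) * (betaJ c' D (j + 2) - betaMu D μ) / betaMu D μ *
                (Real.log y : ℂ)‖ := norm_sub_le _ _
          _ ≤ (‖(1 : ℂ)‖ + ‖betaJ c' D (j + 1) * betaJ c' D (j + 2) / betaMu D μ ^ 2‖) +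
              (5.5 + 60 * |c'|) ^ 2 * π := add_le_add (norm_sub_le _ _) hcoef
          _ ≤ (1 + 4 * (1 + 20 * |c'|) ^ 2) + (5.5 + 60 * |c'|) ^ 2 * π := by
              rw [norm_one]; gcongr
    _ = 1 + 8 * (1 + 20 * |c'|) ^ 2 + (5.5 + 60 * |c'|) ^ 2 * π := by ring

/-! ## `|L′(1,χ)| ≤ 4e^{9/2}𝓛²` -/

/-- **`|L′(1,χ)| ≤ 4e^{9/2}𝓛²`** for `χ` primitive mod `D` with `𝓛 = log D ≥ 3` (the tree's Cauchy
estimate `Lemma31.norm_deriv_LFunction_le_near_one` at `w = 1`, and `(1+𝓛)𝓛 ≤ 2𝓛²`).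
[cite: Zhang2022LandauSiegel, §2 (2.31) p.11] -/
theorem norm_deriv_LFunction_one_le {D : ℕ} [NeZero D] (χ : DirichletCharacter ℂ D)
    (hχ : χ.IsPrimitive) (hL : 3 ≤ ell D) :
    ‖deriv χ.LFunction 1‖ ≤ 4 * Real.exp (9 / 2) * ell D ^ 2 := by
  have hL' : 3 ≤ Real.log D := hL
  have h := Lemma31.norm_deriv_LFunction_le_near_one χ hL' hχ (w := 1)
    (by rw [sub_self, norm_zero]; positivity)
  rw [ell] at *
  have h1 : (1 + Real.log D) * Real.log D ≤ 2 * Real.log D ^ 2 := by nlinarith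
  calc ‖deriv χ.LFunction 1‖ ≤ 2 * Real.exp (9 / 2) * (1 + Real.log D) * Real.log D := h
    _ = 2 * Real.exp (9 / 2) * ((1 + Real.log D) * Real.log D) := by ring
    _ ≤ 2 * Real.exp (9 / 2) * (2 * Real.log D ^ 2) := by gcongr
    _ = 4 * Real.exp (9 / 2) * Real.log D ^ 2 := by ring

/-! ## The inner sums on the tail ranges: trivial bounds -/

/-- Harmonic bound: `Σ_{1 ≤ m < ⌈x⌉} 1/m ≤ 1 + log x` for `x ≥ 1`. [folklore] -/
private theorem sum_Ico_one_ceil_inv_le {x : ℝ} (hx : 1 ≤ x) :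
    ∑ m ∈ Finset.Ico 1 ⌈x⌉₊, (m : ℝ)⁻¹ ≤ 1 + Real.log x := by
  have hn : ⌈x⌉₊ - 1 ≤ ⌊x⌋₊ := by
    have h1 : ⌈x⌉₊ ≤ ⌊x⌋₊ + 1 := Nat.ceil_le_floor_add_one x
    omega
  have hx0 : 0 ≤ x := by linarith
  calc ∑ m ∈ Finset.Ico 1 ⌈x⌉₊, (m : ℝ)⁻¹
      ≤ ∑ m ∈ Finset.Icc 1 ⌊x⌋₊, (m : ℝ)⁻¹ := by
        apply Finset.sum_le_sum_of_subset_of_nonneg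
        · intro m hm
          rw [Finset.mem_Ico] at hm
          rw [Finset.mem_Icc]; omega
        · intros; positivity
    _ = (harmonic ⌊x⌋₊ : ℝ) := by
        rw [harmonic_eq_sum_Icc]; push_cast; rfl
    _ ≤ 1 + Real.log ⌊x⌋₊ := harmonic_le_one_add_log _
    _ ≤ 1 + Real.log x := by
        rcases Nat.eq_zero_or_pos ⌊x⌋₊ with h0 | h0
        · rw [h0]; simp [Real.log_nonneg hx]
        · have : (⌊x⌋₊ : ℝ) ≤ x := Nat.floor_le hx0
          have hpos : (0 : ℝ) < ⌊x⌋₊ := by exact_mod_cast h0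
          linarith [Real.log_le_log hpos this]

/-- The `m`-sum with a tail weight: for `k ≥ 1`, `x = Q/k ≥ 1`, a purely imaginary exponent `γ`
(`Re s = 1` for `s = 1 − β_j`), and a weight with `V(km) = (log Q)⁻¹log(x/m)(x/m)^{β}` for `km < Q`,
`V(km) = 0` for `km ≥ Q` (`Re β = 0`): `|Σ_{m<N} χ(m)V(km)m^{−s}| ≤ (log x/log Q)(1 + log x)`
(window `m < x` inside `m < N`). [cite: Zhang2022LandauSiegel, §8 (8.6) p.45] -/
theorem norm_msum_tail_le {D : ℕ} [NeZero D] (χ : DirichletCharacter ℂ D) {V : ℕ → ℂ}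
    {Q : ℝ} (hQ1 : 1 < Q) {k : ℕ} (hk : 1 ≤ k) {β s : ℂ} (hβ : β.re = 0) (hs : s.re = 1)
    (hVeq : ∀ m : ℕ, 1 ≤ m → ((k * m : ℕ) : ℝ) < Q →
      V (k * m) = ((Real.log (Q / k / m) : ℝ) : ℂ) / (Real.log Q : ℂ) * (((Q / k / m : ℝ) : ℂ)) ^ β)
    (hV0 : ∀ m : ℕ, Q ≤ ((k * m : ℕ) : ℝ) → V (k * m) = 0)
    {N : ℕ} (hN : ⌈Q / k⌉₊ ≤ N) (hx1 : 1 ≤ Q / k) :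
    ‖∑ m ∈ Finset.Ico 1 N, χ (m : ZMod D) * V (k * m) / (m : ℂ) ^ s‖ ≤
      Real.log (Q / k) / Real.log Q * (1 + Real.log (Q / k)) := by
  set x : ℝ := Q / k with hx
  have hkR : (0 : ℝ) < k := by exact_mod_cast hk
  have hQk : Q = (k : ℝ) * x := by rw [hx]; field_simp
  have hlogQ : 0 < Real.log Q := Real.log_pos hQ1
  have hlogx : 0 ≤ Real.log x := Real.log_nonneg hx1
  have hsub : Finset.Ico 1 ⌈x⌉₊ ⊆ Finset.Ico 1 N := Finset.Ico_subset_Ico_right hN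
  -- restrict to the window `m < x`
  have hsum : ∑ m ∈ Finset.Ico 1 N, χ (m : ZMod D) * V (k * m) / (m : ℂ) ^ s =
      ∑ m ∈ Finset.Ico 1 ⌈x⌉₊, χ (m : ZMod D) * V (k * m) / (m : ℂ) ^ s := by
    symm
    apply Finset.sum_subset hsub
    intro m hm hm'
    rw [Finset.mem_Ico] at hm
    rw [Finset.mem_Ico, not_and, not_lt] at hm'
    have hxm : x ≤ m := Nat.ceil_le.mp (hm' hm.1)
    have : Q ≤ ((k * m : ℕ) : ℝ) := by
      rw [hQk]; push_cast; exact mul_le_mul_of_nonneg_left hxm hkR.le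
    rw [hV0 m this, mul_zero, zero_div]
  rw [hsum]
  -- termwise bound `≤ (log x/log Q)/m`
  have hterm : ∀ m ∈ Finset.Ico 1 ⌈x⌉₊,
      ‖χ (m : ZMod D) * V (k * m) / (m : ℂ) ^ s‖ ≤ Real.log x / Real.log Q * (m : ℝ)⁻¹ := by
    intro m hm
    rw [Finset.mem_Ico] at hm
    have hm1 : 1 ≤ m := hm.1
    have hmR : (0 : ℝ) < m := by exact_mod_cast hm1
    have hmx : (m : ℝ) < x := Nat.lt_ceil.mp hm.2
    have hkm : ((k * m : ℕ) : ℝ) < Q := by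
      rw [hQk]; push_cast; exact mul_lt_mul_of_pos_left hmx hkR
    have hxm0 : 0 < x / m := by positivity
    have hxm1 : 1 ≤ x / m := by rw [le_div_iff₀ hmR]; linarith
    rw [hVeq m hm1 hkm, show Q / k / m = x / m by rw [hx]]
    rw [norm_div, norm_mul, norm_mul, norm_div, Complex.norm_real, Complex.norm_real,
      Complex.norm_cpow_eq_rpow_re_of_pos hxm0, hβ, Real.rpow_zero, mul_one,
      Complex.norm_natCast_cpow_of_pos hm1, hs, Real.rpow_one,
      Real.norm_of_nonneg (Real.log_nonneg hxm1), Real.norm_of_nonneg hlogQ.le]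
    have hχ : ‖χ (m : ZMod D)‖ ≤ 1 := DirichletCharacter.norm_le_one χ _
    have hlogxm : Real.log (x / m) ≤ Real.log x := by
      apply Real.log_le_log hxm0
      exact div_le_self (by linarith) (by exact_mod_cast hm1)
    rw [div_eq_mul_inv _ (m : ℝ)]
    apply mul_le_mul _ (le_refl _) (inv_nonneg.mpr hmR.le) (div_nonneg hlogx hlogQ.le)
    calc ‖χ (m : ZMod D)‖ * (Real.log (x / m) / Real.log Q)
        ≤ 1 * (Real.log x / Real.log Q) := by
          apply mul_le_mul hχ _ (div_nonneg (Real.log_nonneg hxm1) hlogQ.le) zero_le_one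
          exact div_le_div_of_nonneg_right hlogxm hlogQ.le
      _ = Real.log x / Real.log Q := by rw [one_mul]
  calc ‖∑ m ∈ Finset.Ico 1 ⌈x⌉₊, χ (m : ZMod D) * V (k * m) / (m : ℂ) ^ s‖
      ≤ ∑ m ∈ Finset.Ico 1 ⌈x⌉₊, ‖χ (m : ZMod D) * V (k * m) / (m : ℂ) ^ s‖ := norm_sum_le _ _
    _ ≤ ∑ m ∈ Finset.Ico 1 ⌈x⌉₊, Real.log x / Real.log Q * (m : ℝ)⁻¹ := Finset.sum_le_sum hterm
    _ = Real.log x / Real.log Q * (∑ m ∈ Finset.Ico 1 ⌈x⌉₊, (m : ℝ)⁻¹) := by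
        rw [Finset.mul_sum]
    _ ≤ Real.log x / Real.log Q * (1 + Real.log x) :=
        mul_le_mul_of_nonneg_left (sum_Ico_one_ceil_inv_le hx1) (by positivity)

/-- The `n`-sum with a tail weight: with `W(kn) = (log Q)⁻¹log(x/n)(x/n)^{β}` for `kn < Q` (`Re β = 0`),
`W(kn) = 0` for `kn ≥ Q`, and any coefficients `ξ`:
`|Σ_{n<N} χ(n)W(kn)ξ(n)/n| ≤ (log x/log Q)·Σ_{n<x}|ξ(n)|/n` (`x = Q/k ≥ 1`).
[cite: Zhang2022LandauSiegel, §8 (8.6) p.45] -/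
theorem norm_nsum_tail_le {D : ℕ} [NeZero D] (χ : DirichletCharacter ℂ D) {W : ℕ → ℂ} (ξ : ℕ → ℂ)
    {Q : ℝ} (hQ1 : 1 < Q) {k : ℕ} (hk : 1 ≤ k) {β : ℂ} (hβ : β.re = 0)
    (hWeq : ∀ n : ℕ, 1 ≤ n → ((k * n : ℕ) : ℝ) < Q →
      W (k * n) = ((Real.log (Q / k / n) : ℝ) : ℂ) / (Real.log Q : ℂ) * (((Q / k / n : ℝ) : ℂ)) ^ β)
    (hW0 : ∀ n : ℕ, Q ≤ ((k * n : ℕ) : ℝ) → W (k * n) = 0)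
    {N : ℕ} (hN : ⌈Q / k⌉₊ ≤ N) (hx1 : 1 ≤ Q / k) :
    ‖∑ n ∈ Finset.Ico 1 N, χ (n : ZMod D) * W (k * n) * ξ n / (n : ℂ)‖ ≤
      Real.log (Q / k) / Real.log Q * (∑ n ∈ Finset.Ico 1 ⌈Q / k⌉₊, ‖ξ n‖ / n) := by
  set x : ℝ := Q / k with hx
  have hkR : (0 : ℝ) < k := by exact_mod_cast hk
  have hQk : Q = (k : ℝ) * x := by rw [hx]; field_simp
  have hlogQ : 0 < Real.log Q := Real.log_pos hQ1
  have hlogx : 0 ≤ Real.log x := Real.log_nonneg hx1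
  have hsub : Finset.Ico 1 ⌈x⌉₊ ⊆ Finset.Ico 1 N := Finset.Ico_subset_Ico_right hN
  have hsum : ∑ n ∈ Finset.Ico 1 N, χ (n : ZMod D) * W (k * n) * ξ n / (n : ℂ) =
      ∑ n ∈ Finset.Ico 1 ⌈x⌉₊, χ (n : ZMod D) * W (k * n) * ξ n / (n : ℂ) := by
    symm
    apply Finset.sum_subset hsub
    intro n hn hn'
    rw [Finset.mem_Ico] at hn
    rw [Finset.mem_Ico, not_and, not_lt] at hn'
    have hxn : x ≤ n := Nat.ceil_le.mp (hn' hn.1)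
    have : Q ≤ ((k * n : ℕ) : ℝ) := by
      rw [hQk]; push_cast; exact mul_le_mul_of_nonneg_left hxn hkR.le
    rw [hW0 n this, mul_zero, zero_mul, zero_div]
  rw [hsum]
  have hterm : ∀ n ∈ Finset.Ico 1 ⌈x⌉₊,
      ‖χ (n : ZMod D) * W (k * n) * ξ n / (n : ℂ)‖ ≤ Real.log x / Real.log Q * (‖ξ n‖ / n) := by
    intro n hn
    rw [Finset.mem_Ico] at hn
    have hn1 : 1 ≤ n := hn.1
    have hnR : (0 : ℝ) < n := by exact_mod_cast hn1
    have hnx : (n : ℝ) < x := Nat.lt_ceil.mp hn.2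
    have hkn : ((k * n : ℕ) : ℝ) < Q := by
      rw [hQk]; push_cast; exact mul_lt_mul_of_pos_left hnx hkR
    have hxn0 : 0 < x / n := by positivity
    have hxn1 : 1 ≤ x / n := by rw [le_div_iff₀ hnR]; linarith
    rw [hWeq n hn1 hkn, show Q / k / n = x / n by rw [hx]]
    rw [norm_div, norm_mul, norm_mul, norm_mul, norm_div, Complex.norm_real, Complex.norm_real,
      Complex.norm_cpow_eq_rpow_re_of_pos hxn0, hβ, Real.rpow_zero, mul_one, Complex.norm_natCast,
      Real.norm_of_nonneg (Real.log_nonneg hxn1), Real.norm_of_nonneg hlogQ.le]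
    have hχ : ‖χ (n : ZMod D)‖ ≤ 1 := DirichletCharacter.norm_le_one χ _
    have hlogxn : Real.log (x / n) ≤ Real.log x := by
      apply Real.log_le_log hxn0
      exact div_le_self (by linarith) (by exact_mod_cast hn1)
    have h2 : ‖χ (n : ZMod D)‖ * (Real.log (x / n) / Real.log Q) ≤ Real.log x / Real.log Q := by
      calc ‖χ (n : ZMod D)‖ * (Real.log (x / n) / Real.log Q)
          ≤ 1 * (Real.log x / Real.log Q) := by
            apply mul_le_mul hχ _ (div_nonneg (Real.log_nonneg hxn1) hlogQ.le) zero_le_one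
            exact div_le_div_of_nonneg_right hlogxn hlogQ.le
        _ = Real.log x / Real.log Q := by rw [one_mul]
    rw [mul_div_assoc]
    exact mul_le_mul_of_nonneg_right h2 (by positivity)
  calc ‖∑ n ∈ Finset.Ico 1 ⌈x⌉₊, χ (n : ZMod D) * W (k * n) * ξ n / (n : ℂ)‖
      ≤ ∑ n ∈ Finset.Ico 1 ⌈x⌉₊, ‖χ (n : ZMod D) * W (k * n) * ξ n / (n : ℂ)‖ := norm_sum_le _ _
    _ ≤ ∑ n ∈ Finset.Ico 1 ⌈x⌉₊, Real.log x / Real.log Q * (‖ξ n‖ / n) := Finset.sum_le_sum hterm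
    _ = Real.log x / Real.log Q * (∑ n ∈ Finset.Ico 1 ⌈x⌉₊, ‖ξ n‖ / n) := by
        rw [Finset.mul_sum]

/-! ## Bookkeeping inequalities -/

/-- `|XY − AB| ≤ |X − A|(|B| + |Y − B|) + |A||Y − B|` — the bookkeeping step of the "simple
approximation" (replace the two inner sums by their main terms). [cite: Zhang2022LandauSiegel, §8 p.47, tex L2436] -/
theorem norm_mul_sub_le (X Y A B : ℂ) :
    ‖X * Y - A * B‖ ≤ ‖X - A‖ * (‖B‖ + ‖Y - B‖) + ‖A‖ * ‖Y - B‖ := by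
  have h : X * Y - A * B = (X - A) * Y + A * (Y - B) := by ring
  have hY : ‖Y‖ ≤ ‖B‖ + ‖Y - B‖ := by
    calc ‖Y‖ = ‖B + (Y - B)‖ := by ring_nf
      _ ≤ ‖B‖ + ‖Y - B‖ := norm_add_le _ _
  rw [h]
  calc ‖(X - A) * Y + A * (Y - B)‖ ≤ ‖(X - A) * Y‖ + ‖A * (Y - B)‖ := norm_add_le _ _
    _ = ‖X - A‖ * ‖Y‖ + ‖A‖ * ‖Y - B‖ := by rw [norm_mul, norm_mul]
    _ ≤ ‖X - A‖ * (‖B‖ + ‖Y - B‖) + ‖A‖ * ‖Y - B‖ := by gcongr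

/-- The four-factor version for `X = M₁ + ιM₂`, `Y = N₁ + ῑN₂`, `A = A₁ + ιA₂`, `B = B₁ + ῑB₂` with
`|ι| ≤ 2`: given `|M_k − A_k| ≤ δ_k`, `|N_k − B_k| ≤ η_k`, `|A_k| ≤ a_k`, `|B_k| ≤ b_k`,
`|XY − AB| ≤ (δ₁ + 2δ₂)(b₁ + 2b₂ + η₁ + 2η₂) + (a₁ + 2a₂)(η₁ + 2η₂)` — the bookkeeping of the "simple
approximation" for the four-term products of the gathering display. [cite: Zhang2022LandauSiegel, §8 p.47, tex L2436] -/
theorem norm_mul_mul_sub_le {ι M₁ M₂ N₁ N₂ A₁ A₂ B₁ B₂ : ℂ} {δ₁ δ₂ η₁ η₂ a₁ a₂ b₁ b₂ : ℝ}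
    (hι : ‖ι‖ ≤ 2) (hM₁ : ‖M₁ - A₁‖ ≤ δ₁) (hM₂ : ‖M₂ - A₂‖ ≤ δ₂) (hN₁ : ‖N₁ - B₁‖ ≤ η₁)
    (hN₂ : ‖N₂ - B₂‖ ≤ η₂) (hA₁ : ‖A₁‖ ≤ a₁) (hA₂ : ‖A₂‖ ≤ a₂) (hB₁ : ‖B₁‖ ≤ b₁)
    (hB₂ : ‖B₂‖ ≤ b₂) :
    ‖(M₁ + ι * M₂) * (N₁ + conj ι * N₂) - (A₁ + ι * A₂) * (B₁ + conj ι * B₂)‖ ≤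
      (δ₁ + 2 * δ₂) * (b₁ + 2 * b₂ + (η₁ + 2 * η₂)) + (a₁ + 2 * a₂) * (η₁ + 2 * η₂) := by
  have hιc : ‖conj ι‖ ≤ 2 := by rwa [Complex.norm_conj]
  have hδ₂ : 0 ≤ δ₂ := le_trans (norm_nonneg _) hM₂
  have hη₂ : 0 ≤ η₂ := le_trans (norm_nonneg _) hN₂
  have ha₂ : 0 ≤ a₂ := le_trans (norm_nonneg _) hA₂
  have hb₂ : 0 ≤ b₂ := le_trans (norm_nonneg _) hB₂
  have hXA : ‖(M₁ + ι * M₂) - (A₁ + ι * A₂)‖ ≤ δ₁ + 2 * δ₂ := by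
    calc ‖(M₁ + ι * M₂) - (A₁ + ι * A₂)‖ = ‖(M₁ - A₁) + ι * (M₂ - A₂)‖ := by ring_nf
      _ ≤ ‖M₁ - A₁‖ + ‖ι‖ * ‖M₂ - A₂‖ := (norm_add_le _ _).trans (by rw [norm_mul])
      _ ≤ δ₁ + 2 * δ₂ := by gcongr
  have hYB : ‖(N₁ + conj ι * N₂) - (B₁ + conj ι * B₂)‖ ≤ η₁ + 2 * η₂ := by
    calc ‖(N₁ + conj ι * N₂) - (B₁ + conj ι * B₂)‖ = ‖(N₁ - B₁) + conj ι * (N₂ - B₂)‖ := by ring_nf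
      _ ≤ ‖N₁ - B₁‖ + ‖conj ι‖ * ‖N₂ - B₂‖ := (norm_add_le _ _).trans (by rw [norm_mul])
      _ ≤ η₁ + 2 * η₂ := by gcongr
  have hA : ‖A₁ + ι * A₂‖ ≤ a₁ + 2 * a₂ := by
    calc ‖A₁ + ι * A₂‖ ≤ ‖A₁‖ + ‖ι‖ * ‖A₂‖ := (norm_add_le _ _).trans (by rw [norm_mul])
      _ ≤ a₁ + 2 * a₂ := by gcongr
  have hB : ‖B₁ + conj ι * B₂‖ ≤ b₁ + 2 * b₂ := by
    calc ‖B₁ + conj ι * B₂‖ ≤ ‖B₁‖ + ‖conj ι‖ * ‖B₂‖ := (norm_add_le _ _).trans (by rw [norm_mul])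
      _ ≤ b₁ + 2 * b₂ := by gcongr
  have hδ : 0 ≤ δ₁ + 2 * δ₂ := le_trans (norm_nonneg _) hXA
  have ha : 0 ≤ a₁ + 2 * a₂ := le_trans (norm_nonneg _) hA
  calc ‖(M₁ + ι * M₂) * (N₁ + conj ι * N₂) - (A₁ + ι * A₂) * (B₁ + conj ι * B₂)‖
      ≤ ‖(M₁ + ι * M₂) - (A₁ + ι * A₂)‖ *
          (‖B₁ + conj ι * B₂‖ + ‖(N₁ + conj ι * N₂) - (B₁ + conj ι * B₂)‖) +
        ‖A₁ + ι * A₂‖ * ‖(N₁ + conj ι * N₂) - (B₁ + conj ι * B₂)‖ := norm_mul_sub_le _ _ _ _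
    _ ≤ (δ₁ + 2 * δ₂) * (b₁ + 2 * b₂ + (η₁ + 2 * η₂)) + (a₁ + 2 * a₂) * (η₁ + 2 * η₂) := by
        gcongr

end Literature.NumberTheory.LFunctions.Zhang2022.Section8FrontEnd44Sizes
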